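/-
Copyright (c) 2026. All rights reserved.
Released under Apache 2.0 license as described in the file LICENSE.
Authors: abc-iut cell — seat abc-iut-w4-d089 (wave 4, gen 9; row «F-1922-AS-TYPED», L3-lead β43 (b)), after abc-iut-L3-t3
(`ArithMaximalCompact.lean`, `ArithmeticCoverings.lean`) and abc-iut-w4-d083 (`ArithQuasiGeometricCompat(Proofs).lean`).
-/
import Literature.AnabelianGeometry.SemiGraphs.ArithQuasiGeometricCompatProofs
import Literature.AnabelianGeometry.SemiGraphs.ArithThm54iiiUmbrellaOuterModel
import HarnessLib

/-!
# [SemiAnbd] Thm 5.4 (iii) AS TYPED (F-1922): the LITERAL clause (3) REDUCED to the compatible one — literal ∧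
# Thm 5.4 (i) ∧ (ii) pins both verticial images over ONE edge-like pair; DISTINCTNESS is exactly the missing datum

Mochizuki, *Semi-graphs of anabelioids*, Publ. RIMS **42** (2006), §5 Def 5.3 p. 65, Thm 5.4 p. 66
[cite: MochizukiSemiAnbd2006, Thm 5.4 (iii), p. 66]: a continuous homomorphism `Π^temp_𝔊 → Π^temp_ℍ` over `Π_A` is
"arithmetically quasi-geometric if [it] maps any arithmetically maximal compact subgroup `K₁ ⊆ Π^temp_𝔊` (respectively,
arithmetically ample intersection `K₁ ∩ H₁` of two distinct arithmetically maximal compact subgroups `K₁, H₁ ⊆ Π^temp_𝔊`)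
to an open subgroup of some arithmetically maximal compact subgroup `K₂ ⊆ Π^temp_ℍ` (respectively, of some arithmetically
ample intersection `K₂ ∩ H₂` of two distinct arithmetically maximal compact subgroups `K₂, H₂ ⊆ Π^temp_ℍ`)"; Thm 5.4 (i):
an arithmetically ample compact subgroup lies in at least one and at most two verticial subgroups; (ii): arithmetically
maximal compact = verticial, arithmetically ample intersections of two distinct such = edge-like.

PROOF-ONLY file (abc-iut cell, layer L3, T54 board / L-F pack B row F-1922 «AS-TYPED», L3-lead ruling β43 (b); seat
abc-iut-w4-d089 gen 9).  No definition, no new named fact, no instance; the frozen statement files are imported, untouched.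
PURE GROUP THEORY over the typed predicates of `ArithMaximalCompact.lean` (`IsArithQuasiGeometric`, `IsArithMaximalCompact`,
`IsArithAmple`, `ArithMaximalCompactStatementI/II`, `IsEdgeLike`) and abc-iut-w4-d083's compatible reading
(`IsArithCompatiblyQuasiGeometric`, `ArithQuasiGeometricCorrespondenceStatementCompat`).

THE POINT.  The frozen LITERAL statement `ArithQuasiGeometricCorrespondenceStatement` (F-1922) and the compatible one
(concluded at the outer models by the integrated Thm 5.4 line v6, p457403) differ ONLY in clause (3): the literal clause asks
that EVERY literally arithmetically quasi-geometric `f` be induced, the compatible clause only those `f` which carry two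
distinct arithmetically maximal compact `K₁ ≠ H₁` with ample meet INTO two DISTINCT ones.  This file proves, in the kernel:

* `IsArithQuasiGeometric.exists_pinned_pair` — if the TARGET satisfies Thm 5.4 (i) ∧ (ii) (as typed, for some
  decomposition data `D`), a literally arithmetically quasi-geometric `f` carries `K₁ ∩ H₁` into ONE arithmetically ample
  edge-like `K₂ ∩ H₂` (`K₂ ≠ H₂` verticial) and BOTH `f(K₁)`, `f(H₁)` into verticial over-groups taken from `{K₂, H₂}` — and
  every arithmetically maximal compact subgroup containing `f(K₁ ∩ H₁)` is `K₂` or `H₂` ("precisely two", Thm 5.4 (i)).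
* `IsArithQuasiGeometric.isArithCompatiblyQuasiGeometric_of_hdist` — hence literal ⟹ compatible as soon as `f` does not
  put `f(K₁)` and `f(H₁)` into ONE arithmetically maximal compact subgroup (the displayed hypothesis `hdist`: "`f` collapses
  no arithmetically ample pair"); the four cases are `(K₂,H₂)`, `(H₂,K₂)` — compatible — and the two FOLDS — excluded by
  `hdist` and by nothing else.
* `IsArithCompatiblyQuasiGeometric.exists_edgeLike_ge_of_collapse` — conversely, a compatibly quasi-geometric `f` that DOES
  collapse such a pair forces an edge-like subgroup of the target to contain the image `f(X)` of an arithmetically maximal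
  compact `X ∈ {K₁, H₁}`, an image which is OPEN in an arithmetically maximal compact subgroup of the target (so `hdist` is
  automatic wherever edge-like subgroups are nowhere open in verticial ones — total elevation; recorded, not used).
* `arithMaximalCompactStatementI_comp_mulEquiv_iff` — Thm 5.4 (i)'s typed statement is invariant under post-composing the
  augmentation with an isomorphism of topological groups (companion of abc-iut-w4-d089 g6's `…StatementII_comp_mulEquiv_iff`).
* `arithQuasiGeometricCorrespondenceStatement_of_compat_of_hdist` — **the F-1922 decl BY NAME**: the frozen LITERAL
  `ArithQuasiGeometricCorrespondenceStatement 𝔊 ℍ e augG augH btemp` follows from the compatible statement, Thm 5.4 (i) ∧ (ii)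
  AS TYPED on the target (for the augmentation `e⁻¹ ∘ augH`) and ONE displayed hypothesis `hdist` quantified over the
  literally arithmetically quasi-geometric `f` over `A^⊤` — a CONDITIONAL CLOSER with a single, print-meaningful residual
  (sharper than the three-clause assembly `…Compat_of_clauses`).

HONEST LABEL.  `hdist` is NOT claimed derivable: it is the arithmetic shadow of the COLLAPSE FOLD (cell finding O-T54-1 /
t2g2-F1; the geometric fold is a kernel theorem at the estranged loop, abc-iut-L3-t12's `IwahoriWitness.exists_collapseFold`,
and separates the two readings of Def. 3.8, abc-iut-w6-d099's `…isQuasiGeometric_not_isCompatiblyQuasiGeometric`); at a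
Thm-5.4-frame carrier WITH an edge admitting a `Π_A`-equivariant fold the literal clause (3) is expected to FAIL — that
refutation is NOT in this file (β43 (c): shapes only).  Typed ≠ proved; nothing here bears on [IUTchIII] Cor. 3.12.
-/

namespace Literature.AnabelianGeometry.SemiGraphs

open _root_.Topology

universe u v w uG uH uP uQ uV uB

/-! ### Pure group theory: literal ∧ Thm 5.4 (i) ∧ (ii) on the target ⟹ compatible, modulo collapse -/

section Reduction

variable {Gtp : Type uG} [Group Gtp] [TopologicalSpace Gtp]
variable {Htp : Type uH} [Group Htp] [TopologicalSpace Htp]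
variable {PA : Type uP} [Group PA] [TopologicalSpace PA]
variable {V : Type uV} {B : Type uB}

/-- The image under a literally arithmetically quasi-geometric `f` of the meet `K₁ ∩ H₁` of two compact subgroups with
arithmetically ample meet is compact (Hausdorff source) and arithmetically ample for the target augmentation (because
`augH ∘ f = augG`). [cite: MochizukiSemiAnbd2006, Def 5.3 (i), p. 65] -/
theorem IsArithQuasiGeometric.isCompact_and_isArithAmple_map_inf [T2Space Gtp] {augG : Gtp →* PA} {augH : Htp →* PA}
    {f : Gtp →* Htp} (hf : IsArithQuasiGeometric augG augH f) {K₁ H₁ : Subgroup Gtp}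
    (hK₁ : IsCompact (K₁ : Set Gtp)) (hH₁ : IsCompact (H₁ : Set Gtp)) (ha : IsArithAmple augG (K₁ ⊓ H₁)) :
    IsCompact (((K₁ ⊓ H₁).map f : Subgroup Htp) : Set Htp) ∧ IsArithAmple augH ((K₁ ⊓ H₁).map f) := by
  refine ⟨?_, ?_⟩
  · rw [Subgroup.coe_map, Subgroup.coe_inf]
    exact (hK₁.inter_right hH₁.isClosed).image hf.1
  · unfold IsArithAmple at ha ⊢
    rw [Subgroup.map_map, hf.2.1]
    exact ha

/-- **Literal ∧ Thm 5.4 (i) ∧ (ii) pins both images over ONE edge-like pair.**  Let the target carry decomposition data `D`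
for which Thm 5.4 (i) and (ii) hold AS TYPED, and let `f` be arithmetically quasi-geometric in the LITERAL sense.  For two
distinct arithmetically maximal compact `K₁ ≠ H₁` of the source with arithmetically ample meet there are two DISTINCT
arithmetically maximal compact `K₂ ≠ H₂` of the target with arithmetically ample, EDGE-LIKE meet `K₂ ∩ H₂ ⊇ f(K₁ ∩ H₁)`, such
that `f(K₁) ⊆ K₂` or `⊆ H₂`, `f(H₁) ⊆ K₂` or `⊆ H₂`, and every arithmetically maximal compact subgroup of the target containing
`f(K₁ ∩ H₁)` is `K₂` or `H₂` (Thm 5.4 (i): "precisely two"). [cite: MochizukiSemiAnbd2006, Thm 5.4, p. 66] -/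
theorem IsArithQuasiGeometric.exists_pinned_pair [T2Space Gtp] {D : DecompositionData Htp V B} {augG : Gtp →* PA}
    {augH : Htp →* PA} {f : Gtp →* Htp} (hf : IsArithQuasiGeometric augG augH f)
    (hI : ArithMaximalCompactStatementI D augH) (hII : ArithMaximalCompactStatementII D augH)
    {K₁ H₁ : Subgroup Gtp} (hK₁ : IsArithMaximalCompact augG K₁) (hH₁ : IsArithMaximalCompact augG H₁) (hne : K₁ ≠ H₁)
    (ha : IsArithAmple augG (K₁ ⊓ H₁)) :
    ∃ K₂ H₂ : Subgroup Htp, IsArithMaximalCompact augH K₂ ∧ IsArithMaximalCompact augH H₂ ∧ K₂ ≠ H₂ ∧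
      IsArithAmple augH (K₂ ⊓ H₂) ∧ IsEdgeLike D (K₂ ⊓ H₂) ∧ (K₁ ⊓ H₁).map f ≤ K₂ ⊓ H₂ ∧
      (K₁.map f ≤ K₂ ∨ K₁.map f ≤ H₂) ∧ (H₁.map f ≤ K₂ ∨ H₁.map f ≤ H₂) ∧
      ∀ M : Subgroup Htp, IsArithMaximalCompact augH M → (K₁ ⊓ H₁).map f ≤ M → M = K₂ ∨ M = H₂ := by
  obtain ⟨K₂, H₂, hK₂, hH₂, hne₂, ha₂, hmo⟩ := hf.2.2.2 K₁ H₁ hK₁ hH₁ hne ha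
  obtain ⟨hLc, hLa⟩ := hf.isCompact_and_isArithAmple_map_inf hK₁.1 hH₁.1 ha
  -- Thm 5.4 (i) at the compact, arithmetically ample `f(K₁ ∩ H₁) ⊆ K₂ ∩ H₂`: its verticial over-groups are exactly `K₂`, `H₂`
  have hW : ∀ W₃ : Subgroup Htp, IsVerticial D W₃ → (K₁ ⊓ H₁).map f ≤ W₃ → W₃ = K₂ ∨ W₃ = H₂ :=
    ((hI _ hLc hLa).2 K₂ H₂ ((hII.1 K₂).1 hK₂) ((hII.1 H₂).1 hH₂) hne₂ (hmo.1.trans inf_le_left)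
      (hmo.1.trans inf_le_right)).1
  have hM : ∀ M : Subgroup Htp, IsArithMaximalCompact augH M → (K₁ ⊓ H₁).map f ≤ M → M = K₂ ∨ M = H₂ :=
    fun M hM' hle => hW M ((hII.1 M).1 hM') hle
  -- the single-subgroup clause of the literal condition at `K₁` and at `H₁`
  obtain ⟨K₂', hK₂', hmoK⟩ := hf.2.2.1 K₁ hK₁
  obtain ⟨H₂', hH₂', hmoH⟩ := hf.2.2.1 H₁ hH₁
  have hK' := hM K₂' hK₂' ((Subgroup.map_mono inf_le_left).trans hmoK.1)
  have hH' := hM H₂' hH₂' ((Subgroup.map_mono inf_le_right).trans hmoH.1)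
  refine ⟨K₂, H₂, hK₂, hH₂, hne₂, ha₂, (hII.2 _).1 ⟨ha₂, K₂, H₂, hK₂, hH₂, hne₂, rfl⟩, hmo.1, ?_, ?_, hM⟩
  · rcases hK' with rfl | rfl
    exacts [Or.inl hmoK.1, Or.inr hmoK.1]
  · rcases hH' with rfl | rfl
    exacts [Or.inl hmoH.1, Or.inr hmoH.1]

/-- **Literal ⟹ compatible, modulo collapse.**  If the target satisfies Thm 5.4 (i) ∧ (ii) AS TYPED and the literally
arithmetically quasi-geometric `f` does not carry two distinct arithmetically maximal compact `K₁ ≠ H₁` with arithmetically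
ample meet into ONE arithmetically maximal compact subgroup (`hdist` — "`f` collapses no arithmetically ample pair"), then `f`
is arithmetically quasi-geometric in the COMPATIBLE sense.  By `exists_pinned_pair` the four positions of `(f(K₁), f(H₁))`
are `(K₂,H₂)`, `(H₂,K₂)` — compatible — and the two folds `(K₂,K₂)`, `(H₂,H₂)` — excluded by `hdist` and by nothing else.
[cite: MochizukiSemiAnbd2006, Thm 5.4 (iii), p. 66] -/
theorem IsArithQuasiGeometric.isArithCompatiblyQuasiGeometric_of_hdist [T2Space Gtp] {D : DecompositionData Htp V B}
    {augG : Gtp →* PA} {augH : Htp →* PA} {f : Gtp →* Htp} (hf : IsArithQuasiGeometric augG augH f)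
    (hI : ArithMaximalCompactStatementI D augH) (hII : ArithMaximalCompactStatementII D augH)
    (hdist : ∀ K₁ H₁ : Subgroup Gtp, IsArithMaximalCompact augG K₁ → IsArithMaximalCompact augG H₁ → K₁ ≠ H₁ →
      IsArithAmple augG (K₁ ⊓ H₁) → ∀ M : Subgroup Htp, IsArithMaximalCompact augH M →
        K₁.map f ≤ M → H₁.map f ≤ M → False) :
    IsArithCompatiblyQuasiGeometric augG augH f := by
  refine isArithCompatiblyQuasiGeometric_of_compat hf fun K₁ H₁ hK₁ hH₁ hne ha => ?_
  obtain ⟨K₂, H₂, hK₂, hH₂, hne₂, -, -, -, hK, hH, -⟩ := hf.exists_pinned_pair hI hII hK₁ hH₁ hne ha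
  rcases hK with hK | hK <;> rcases hH with hH | hH
  · exact (hdist K₁ H₁ hK₁ hH₁ hne ha K₂ hK₂ hK hH).elim
  · exact ⟨K₂, H₂, hK₂, hH₂, hne₂, hK, hH⟩
  · exact ⟨H₂, K₂, hH₂, hK₂, hne₂.symm, hK, hH⟩
  · exact (hdist K₁ H₁ hK₁ hH₁ hne ha H₂ hH₂ hK hH).elim

/-- **Converse: a collapse forces an edge-like subgroup to swallow an open image.**  If the target satisfies Thm 5.4 (i) ∧
(ii) AS TYPED and a COMPATIBLY arithmetically quasi-geometric `f` nevertheless carries `f(K₁)`, `f(H₁)` (for `K₁ ≠ H₁`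
arithmetically maximal compact with arithmetically ample meet) into one arithmetically maximal compact `M`, then some
`X ∈ {K₁, H₁}` has its image `f(X)` inside an EDGE-LIKE subgroup `E` of the target, while `f(X)` is (by the literal
condition) an OPEN subgroup of an arithmetically maximal compact `X₂ ⊇ E`.  So `hdist` holds automatically wherever no
edge-like subgroup of the target contains an open subgroup of a verticial one (total elevation) — recorded here, not used.
[cite: MochizukiSemiAnbd2006, Thm 5.4 (iii), p. 66] -/
theorem IsArithCompatiblyQuasiGeometric.exists_edgeLike_ge_of_collapse [T2Space Gtp] {D : DecompositionData Htp V B}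
    {augG : Gtp →* PA} {augH : Htp →* PA} {f : Gtp →* Htp} (hf : IsArithCompatiblyQuasiGeometric augG augH f)
    (hI : ArithMaximalCompactStatementI D augH) (hII : ArithMaximalCompactStatementII D augH)
    {K₁ H₁ : Subgroup Gtp} (hK₁ : IsArithMaximalCompact augG K₁) (hH₁ : IsArithMaximalCompact augG H₁) (hne : K₁ ≠ H₁)
    (ha : IsArithAmple augG (K₁ ⊓ H₁)) {M : Subgroup Htp} (hM : IsArithMaximalCompact augH M)
    (hKM : K₁.map f ≤ M) (hHM : H₁.map f ≤ M) :
    ∃ (X : Subgroup Gtp) (E X₂ : Subgroup Htp), (X = K₁ ∨ X = H₁) ∧ IsEdgeLike D E ∧ IsArithMaximalCompact augH X₂ ∧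
      X.map f ≤ E ∧ E ≤ X₂ ∧ MapsOntoOpenSubgroupOf f X X₂ := by
  obtain ⟨K₂, H₂, hK₂, hH₂, hne₂, -, hE, -, hK, hH, hM'⟩ := hf.1.exists_pinned_pair hI hII hK₁ hH₁ hne ha
  obtain ⟨A, B', hA, hB, hAB, hKA, hHB⟩ := hf.2 K₁ H₁ hK₁ hH₁ hne ha
  -- `A`, `B'`, `M` all contain `f(K₁ ∩ H₁)`, hence each is `K₂` or `H₂`
  have hA' := hM' A hA ((Subgroup.map_mono inf_le_left).trans hKA)
  have hB'' := hM' B' hB ((Subgroup.map_mono inf_le_right).trans hHB)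
  have hMM := hM' M hM ((Subgroup.map_mono inf_le_left).trans hKM)
  -- the single-subgroup clause of the literal condition: `f(K₁)` open in some `K₂'`, `f(H₁)` open in some `H₂'`
  obtain ⟨K₂', hK₂', hmoK⟩ := hf.1.2.2.1 K₁ hK₁
  obtain ⟨H₂', hH₂', hmoH⟩ := hf.1.2.2.1 H₁ hH₁
  -- some `X ∈ {K₁, H₁}` has `f(X) ⊆ K₂ ∩ H₂`
  have hX : (K₁.map f ≤ K₂ ⊓ H₂) ∨ (H₁.map f ≤ K₂ ⊓ H₂) := by
    rcases hA' with rfl | rfl <;> rcases hB'' with rfl | rfl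
    · exact (hAB rfl).elim
    · rcases hMM with rfl | rfl
      exacts [Or.inr (le_inf hHM hHB), Or.inl (le_inf hKA hKM)]
    · rcases hMM with rfl | rfl
      exacts [Or.inl (le_inf hKM hKA), Or.inr (le_inf hHB hHM)]
    · exact (hAB rfl).elim
  rcases hX with hX | hX
  · have hK'' := hM' K₂' hK₂' ((Subgroup.map_mono inf_le_left).trans hmoK.1)
    refine ⟨K₁, K₂ ⊓ H₂, K₂', Or.inl rfl, hE, hK₂', hX, ?_, hmoK⟩
    rcases hK'' with rfl | rfl
    exacts [inf_le_left, inf_le_right]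
  · have hH'' := hM' H₂' hH₂' ((Subgroup.map_mono inf_le_right).trans hmoH.1)
    refine ⟨H₁, K₂ ⊓ H₂, H₂', Or.inr rfl, hE, hH₂', hX, ?_, hmoH⟩
    rcases hH'' with rfl | rfl
    exacts [inf_le_left, inf_le_right]

end Reduction

/-! ### Transport of Thm 5.4 (i)'s typed statement along an isomorphism of the arithmetic quotient -/

section Transport

variable {Gtp : Type uG} [Group Gtp] [TopologicalSpace Gtp]
  {PA₁ : Type uP} [Group PA₁] [TopologicalSpace PA₁] {PA₂ : Type uQ} [Group PA₂] [TopologicalSpace PA₂]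
  {V : Type uV} {B : Type uB}

/-- Thm 5.4 (i)'s statement ([SemiAnbd] p. 66) is invariant under post-composing the augmentation with an isomorphism of
topological groups (companion of `arithMaximalCompactStatementII_comp_mulEquiv_iff`). [cite: MochizukiSemiAnbd2006, Thm 5.4 (i), p. 66] -/
theorem arithMaximalCompactStatementI_comp_mulEquiv_iff (e : PA₂ ≃* PA₁) (he : Continuous e)
    (he' : Continuous e.symm) (D : DecompositionData Gtp V B) (aug : Gtp →* PA₂) :
    ArithMaximalCompactStatementI D (e.toMonoidHom.comp aug) ↔ ArithMaximalCompactStatementI D aug := by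
  simp only [ArithMaximalCompactStatementI, isArithAmple_comp_mulEquiv_iff e he he']

end Transport

/-! ### The frozen literal statement (F-1922) from the compatible one, modulo `hdist` -/

section Thm54iii

variable {Obj : Type u} [CategoryTheory.Category.{v} Obj] {𝓥 : SemiAnbdVocab.{u, v, w} Obj}
variable {𝔊 ℍ : ArithSemiGraph 𝓥} {e : 𝔊.PA ≃* ℍ.PA}
variable {Gtp : Type uG} [Group Gtp] [TopologicalSpace Gtp]
variable {Htp : Type uH} [Group Htp] [TopologicalSpace Htp]
variable {V : Type uV} {B : Type uB}

/-- **[SemiAnbd] Thm 5.4 (iii) AS TYPED (F-1922) — the frozen LITERAL `ArithQuasiGeometricCorrespondenceStatement` BY NAME,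
from the compatible statement modulo ONE displayed hypothesis.**  Given: the compatible statement (abc-iut-w4-d083's
`ArithQuasiGeometricCorrespondenceStatementCompat`, concluded at the outer models by the integrated line v6); decomposition
data `D` on `Π^temp_ℍ` for which Thm 5.4 (i) and (ii) hold AS TYPED for the augmentation `e⁻¹ ∘ augH` to `π̂₁(A)`; a
Hausdorff `Π^temp_𝔊`; and `hdist`: no LITERALLY arithmetically quasi-geometric `f : Π^temp_𝔊 → Π^temp_ℍ` over `A^⊤` carries
two distinct arithmetically maximal compact subgroups with arithmetically ample meet into one arithmetically maximal compact
subgroup.  Then the LITERAL statement holds: clause (1) by projection, clause (2) verbatim, clause (3) because `hdist` makes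
every literally arithmetically quasi-geometric `f` compatibly so (`isArithCompatiblyQuasiGeometric_of_hdist`).  CONDITIONAL
closer: `hdist` is the arithmetic shadow of the collapse fold and is NOT claimed derivable (module docstring).
[cite: MochizukiSemiAnbd2006, Thm 5.4 (iii), p. 66] -/
theorem arithQuasiGeometricCorrespondenceStatement_of_compat_of_hdist [T2Space Gtp] {augG : Gtp →* 𝔊.PA}
    {augH : Htp →* ℍ.PA} {btemp : (φ : ArithHom 𝓥 𝔊 ℍ) → φ.IsLocallyOpen → ArithHom.IsOverA 𝔊 ℍ e φ → (Gtp →* Htp)}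
    (h : ArithQuasiGeometricCorrespondenceStatementCompat 𝔊 ℍ e augG augH btemp) (D : DecompositionData Htp V B)
    (hI : ArithMaximalCompactStatementI D (e.symm.toMonoidHom.comp augH))
    (hII : ArithMaximalCompactStatementII D (e.symm.toMonoidHom.comp augH))
    (hdist : ∀ f : Gtp →* Htp, IsArithQuasiGeometric augG (e.symm.toMonoidHom.comp augH) f →
      ∀ K₁ H₁ : Subgroup Gtp, IsArithMaximalCompact augG K₁ → IsArithMaximalCompact augG H₁ → K₁ ≠ H₁ →
        IsArithAmple augG (K₁ ⊓ H₁) → ∀ M : Subgroup Htp, IsArithMaximalCompact (e.symm.toMonoidHom.comp augH) M →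
          K₁.map f ≤ M → H₁.map f ≤ M → False) :
    ArithQuasiGeometricCorrespondenceStatement 𝔊 ℍ e augG augH btemp :=
  ⟨h.clause1_literal, h.2.1, fun f hf => h.2.2 f (hf.isArithCompatiblyQuasiGeometric_of_hdist hI hII (hdist f hf))⟩

end Thm54iii

end Literature.AnabelianGeometry.SemiGraphs
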